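import Summits.BirchSwinnertonDyer.Rank1Residual.ManinAdditive.UDCKummerLine
import Summits.BirchSwinnertonDyer.BirchSwinnertonDyer.Theorems.ManinLocalTwoThreeShimuraQuotientEisenstein
import Literature.NumberTheory.EllipticCurves.ModularSymbolsParabolicCohomology
import HarnessLib

/-!
# (NC-a) `UDCKummerLine.KummerCoverSubgroup` IS A THEOREM: the Kummer cover group `Γ_T = ker χ_T` is a finite-index subgroup of
# `Γ₀(N)`, normal, containing every element of trace `±2`
Summit `BirchSwinnertonDyer`, route `ManinLocalTwoThree` (cell bsd-f2-manin), crux C3 `ManinPrimeToThreeAtNine` (stmt-BirchSwinnertonDyer-22968);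
lead p1 gen 15.  Node (NC-a) of -an g37's UDC line (MEMO-an §80.12; `Summits/…/ManinAdditive/UDCKummerLine.lean`, T-an-43): pure bookkeeping,
closed here so that the C3 skeleton v21 does not carry it as a stub.
For a datum `D` (lattice clause `Λ_E ⊆ c·Λ_f`) and `u ∉ Λ_E`, `3u ∈ Λ_E`, put `H = ℤ·3u + 3Λ_E` and
`Γ_T = {γ ∈ Γ₀(N) : c·{∞, γ∞}_f ∈ H}` (`UDCKummerLine.KummerPeriodTrivial`).
* §1 `exists_three_classes_of_three_mul_mem` — the `𝔽₃`-structure: for one `r ∈ Λ_E`, every `x ∈ Λ_E` is `≡ 0, r` or `2r (mod H)`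
  (coordinates `x = mω₁ + nω₂`, `3u = αω₁ + βω₂` with `(α, β) ≢ 0 (mod 3)`);
* §2 **`kummerCoverSubgroup_holds : KummerCoverSubgroup`** — `Γ_T` is a subgroup (Manin's homomorphism `cuspSymbol_mul_holds`,
  `cuspSymbol_inv`), `≤ Γ₀(N)`, NORMAL in `Γ₀(N)` (kernel of a homomorphism to an abelian group), of FINITE INDEX in `SL₂(ℤ)`
  (`SL₂(ℤ)/Γ_T` is the image of `(SL₂(ℤ)/Γ₀(N)) × {0,1,2}`: `γ ≡ γ₀^j (mod Γ_T)` with `c·{∞, γ₀∞}_f = r`), and contains every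
  `γ ∈ Γ₀(N)` of trace `±2` (zero discriminant ⟹ zero period, tree `cuspSymbol_eq_zero_of_discr_eq_zero`).
HONEST FRAMING: bookkeeping only; (NC-b), (AN), the UDC input, C3, Manin's conjecture and BSD are NOT proved here.  No definitions
(the subgroup is an existential witness), no sorry.
[cite: KurthLong2008, Def. 16 and Prop. 18 (type II character groups; shape of the hypotheses only)] [cite: Manin1972, Prop. 1.4 / Thm. 1.6]
-/

set_option autoImplicit false
-- the summit-side namespace `Summit.BirchSwinnertonDyer.BirchSwinnertonDyer.…` is the tree's (summit = sub-problem)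
set_option linter.dupNamespace false

noncomputable section

open scoped MatrixGroups ModularForm
open CongruenceSubgroup WeierstrassCurve Literature.NumberTheory.EllipticCurves
  Literature.NumberTheory.EllipticCurves.ModularForms
  Summit.BirchSwinnertonDyer.Rank1Residual.ManinAdditive
  Summit.BirchSwinnertonDyer.Rank1Residual.ManinAdditive.UDCKummerLine

namespace Summit.BirchSwinnertonDyer.BirchSwinnertonDyer.Theorems.ManinLocalTwoThree

/-! ## §1 The `𝔽₃`-structure of `Λ/(ℤ·3u + 3Λ)` -/

/-- One coordinate case: `3u = αω₁ + βω₂` with `3 ∤ β` ⟹ `r = ω₁` works. -/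
theorem exists_three_classes_of_three_mul_mem_aux (L : PeriodPair) {u : ℂ} {α β : ℤ}
    (hαβ : (α : ℂ) * L.ω₁ + (β : ℂ) * L.ω₂ = 3 * u) (hβ : ¬ (3 : ℤ) ∣ β) :
    ∀ x ∈ L.lattice, ∃ j : ℕ, j < 3 ∧ ∃ k : ℤ, ∃ ν ∈ L.lattice, x - (j : ℂ) * L.ω₁ = k * (3 * u) + 3 * ν := by
  intro x hx
  obtain ⟨m, n, hmn⟩ := PeriodPair.mem_lattice.mp hx
  -- `k` with `kβ ≡ n (mod 3)` and the quotient `q₂ = (n − kβ)/3`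
  obtain ⟨k, q₂, hk⟩ : ∃ k q₂ : ℤ, n - k * β = 3 * q₂ := by
    have hβ3 : β % 3 = 1 ∨ β % 3 = 2 := by omega
    rcases hβ3 with h1 | h2
    · obtain ⟨t, ht⟩ : ∃ t, β = 3 * t + 1 := ⟨β / 3, by omega⟩
      exact ⟨n, -(n * t), by rw [ht]; ring⟩
    · obtain ⟨t, ht⟩ : ∃ t, β = 3 * t + 2 := ⟨β / 3, by omega⟩
      exact ⟨-n, n * t + n, by rw [ht]; ring⟩
  -- `j = (m − kα) mod 3`, `q₁ = (m − kα − j)/3`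
  obtain ⟨j, q₁, hj3, hj⟩ : ∃ (j : ℕ) (q₁ : ℤ), j < 3 ∧ m - k * α - j = 3 * q₁ := by
    refine ⟨((m - k * α) % 3).toNat, (m - k * α) / 3, ?_, ?_⟩ <;> omega
  refine ⟨j, hj3, k, (q₁ : ℂ) * L.ω₁ + (q₂ : ℂ) * L.ω₂, ?_, ?_⟩
  · exact PeriodPair.mem_lattice.mpr ⟨q₁, q₂, rfl⟩
  · rw [← hmn, ← hαβ]
    have hj' : ((j : ℤ) : ℂ) = (j : ℂ) := by norm_cast
    have e1 : (m : ℂ) = k * α + 3 * q₁ + (j : ℤ) := by exact_mod_cast (by linarith : m = k * α + 3 * q₁ + j)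
    have e2 : (n : ℂ) = k * β + 3 * q₂ := by exact_mod_cast (by linarith : n = k * β + 3 * q₂)
    rw [e1, e2, hj']
    ring

/-- **Three classes.**  If `u ∉ Λ` and `3u ∈ Λ` then for one `r ∈ Λ` every `x ∈ Λ` satisfies `x − j·r ∈ ℤ·3u + 3Λ` for some `j ∈ {0,1,2}`
(`Λ/(ℤ·3u + 3Λ) ≅ ℤ/3`). [folklore] -/
theorem exists_three_classes_of_three_mul_mem (L : PeriodPair) {u : ℂ} (hu : u ∉ L.lattice) (h3u : 3 * u ∈ L.lattice) :
    ∃ r ∈ L.lattice, ∀ x ∈ L.lattice, ∃ j : ℕ, j < 3 ∧ ∃ k : ℤ, ∃ ν ∈ L.lattice, x - (j : ℂ) * r = k * (3 * u) + 3 * ν := by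
  obtain ⟨α, β, hαβ⟩ := PeriodPair.mem_lattice.mp h3u
  by_cases hβ : (3 : ℤ) ∣ β
  · -- then `3 ∤ α` (else `u ∈ Λ`); use `r = ω₂` via the swapped pair
    have hα : ¬ (3 : ℤ) ∣ α := by
      rintro ⟨α', rfl⟩
      obtain ⟨β', rfl⟩ := hβ
      apply hu
      refine PeriodPair.mem_lattice.mpr ⟨α', β', ?_⟩
      have h3 : (3 : ℂ) ≠ 0 := by norm_num
      apply mul_left_cancel₀ h3
      rw [← hαβ]; push_cast; ring
    let L' : PeriodPair := ⟨L.ω₂, L.ω₁, by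
      have h := L.indep
      rw [LinearIndependent.pair_iff] at h ⊢
      intro s t hst
      have := h t s (by rw [add_comm]; simpa [add_comm] using hst)
      exact ⟨this.2, this.1⟩⟩
    have hL' : ∀ x, x ∈ L'.lattice ↔ x ∈ L.lattice := fun x ↦ by
      simp only [PeriodPair.mem_lattice]
      constructor
      · rintro ⟨m, n, h⟩; exact ⟨n, m, by rw [← h]; ring⟩
      · rintro ⟨m, n, h⟩; exact ⟨n, m, by rw [← h]; ring⟩
    have hαβ' : (β : ℂ) * L'.ω₁ + (α : ℂ) * L'.ω₂ = 3 * u := by rw [← hαβ]; show (β : ℂ) * L.ω₂ + α * L.ω₁ = _; ring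
    refine ⟨L.ω₂, L.ω₂_mem_lattice, fun x hx ↦ ?_⟩
    obtain ⟨j, hj, k, ν, hν, e⟩ := exists_three_classes_of_three_mul_mem_aux L' hαβ' hα x ((hL' x).mpr hx)
    exact ⟨j, hj, k, ν, (hL' ν).mp hν, e⟩
  · exact ⟨L.ω₁, L.ω₁_mem_lattice, exists_three_classes_of_three_mul_mem_aux L hαβ hβ⟩

/-! ## §2 The Kummer cover group -/

/-- **(NC-a) `KummerCoverSubgroup` HOLDS** (UDC line of -an g37, MEMO-an §80.12): for every datum `D` with the lattice clause and every
`u ∉ Λ_E` with `3u ∈ Λ_E`, `Γ_T = {γ ∈ Γ₀(N) : c·{∞,γ∞}_f ∈ ℤ·3u + 3Λ_E}` is a finite-index subgroup of `SL₂(ℤ)` inside `Γ₀(N)`,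
normal in `Γ₀(N)`, containing all elements of trace `±2`. [cite: KurthLong2008, Def. 16 (type II; shape only)] [cite: Manin1972, Prop. 1.4 / Thm. 1.6] -/
theorem kummerCoverSubgroup_holds : KummerCoverSubgroup := by
  intro W _ _ N _ D h₀ u hu h3u
  have hc : (D.c : ℂ) ≠ 0 := by exact_mod_cast D.maninConstant_ne_zero_holds
  -- the subgroup
  let Γ : Subgroup SL(2, ℤ) :=
    { carrier := {g | ∃ hg : g ∈ Gamma0 N, KummerPeriodTrivial D u ⟨g, hg⟩}
      one_mem' := by
        refine ⟨(Gamma0 N).one_mem, 0, 0, zero_mem _, ?_⟩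
        have : (⟨1, (Gamma0 N).one_mem⟩ : Gamma0 N) = 1 := rfl
        rw [this, cuspSymbol_one]; simp
      mul_mem' := by
        rintro g₁ g₂ ⟨hg₁, k₁, ν₁, hν₁, e₁⟩ ⟨hg₂, k₂, ν₂, hν₂, e₂⟩
        refine ⟨(Gamma0 N).mul_mem hg₁ hg₂, k₁ + k₂, ν₁ + ν₂, add_mem hν₁ hν₂, ?_⟩
        have : (⟨g₁ * g₂, (Gamma0 N).mul_mem hg₁ hg₂⟩ : Gamma0 N) = ⟨g₁, hg₁⟩ * ⟨g₂, hg₂⟩ := rfl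
        rw [this, cuspSymbol_mul_holds, mul_add, e₁, e₂]; push_cast; ring
      inv_mem' := by
        rintro g ⟨hg, k, ν, hν, e⟩
        refine ⟨(Gamma0 N).inv_mem hg, -k, -ν, neg_mem hν, ?_⟩
        have : (⟨g⁻¹, (Gamma0 N).inv_mem hg⟩ : Gamma0 N) = ⟨g, hg⟩⁻¹ := rfl
        rw [this, cuspSymbol_inv, mul_neg, e]; push_cast; ring }
  have hmem : ∀ γ : Gamma0 N, (γ : SL(2, ℤ)) ∈ Γ ↔ KummerPeriodTrivial D u γ := fun γ ↦
    ⟨fun ⟨_, h⟩ ↦ h, fun h ↦ ⟨γ.2, h⟩⟩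
  refine ⟨Γ, hmem, fun g hg ↦ hg.1, ?_, ?_, ?_⟩
  · -- FINITE INDEX: three cosets over `Γ₀(N)`
    obtain ⟨r, hr, hthree⟩ := exists_three_classes_of_three_mul_mem D.L hu h3u
    -- `r = c·{∞, γ₀∞}_f`
    obtain ⟨w, hw, hrw⟩ := h₀ r hr
    have hw' : w ∈ (periodLattice D.f : Set ℂ) := hw
    rw [coe_periodLattice_eq_range] at hw'
    obtain ⟨γ₀, rfl⟩ := hw'
    -- every `γ ∈ Γ₀(N)` lies in `γ₀^j Γ` for some `j < 3`
    have hcoset : ∀ γ : Gamma0 N, ∃ j : ℕ, j < 3 ∧ ((γ₀ : SL(2, ℤ)) ^ j)⁻¹ * (γ : SL(2, ℤ)) ∈ Γ := by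
      intro γ
      have hx : (D.c : ℂ) * cuspSymbol D.f γ ∈ D.L.lattice := D.smul_periodLattice_le _ (cuspSymbol_mem_periodLattice D.f γ)
      obtain ⟨j, hj, k, ν, hν, e⟩ := hthree _ hx
      refine ⟨j, hj, (hmem ((γ₀ ^ j)⁻¹ * γ)).mpr ⟨k, ν, hν, ?_⟩⟩
      rw [cuspSymbol_mul_holds, cuspSymbol_inv, cuspSymbol_pow_eq_natCast_mul, ← e, hrw]; ring
    haveI : Finite (SL(2, ℤ) ⧸ Γ) := by
      refine Finite.of_surjective
        (fun p : (SL(2, ℤ) ⧸ Gamma0 N) × Fin 3 ↦ (QuotientGroup.mk (p.1.out * (γ₀ : SL(2, ℤ)) ^ (p.2 : ℕ)) : SL(2, ℤ) ⧸ Γ))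
        ?_
      intro q
      induction q using QuotientGroup.induction_on with
      | H g =>
        obtain ⟨h, hh⟩ := QuotientGroup.mk_out_eq_mul (Gamma0 N) g
        obtain ⟨j, hj, hδ⟩ := hcoset h⁻¹
        refine ⟨(QuotientGroup.mk g, ⟨j, hj⟩), ?_⟩
        show (QuotientGroup.mk ((QuotientGroup.mk g : SL(2, ℤ) ⧸ Gamma0 N).out * (γ₀ : SL(2, ℤ)) ^ j) : SL(2, ℤ) ⧸ Γ) =
          QuotientGroup.mk g
        rw [QuotientGroup.eq, hh]
        have e : ((g : SL(2, ℤ)) * (h : SL(2, ℤ)) * (γ₀ : SL(2, ℤ)) ^ j)⁻¹ * g =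
            ((γ₀ : SL(2, ℤ)) ^ j)⁻¹ * ((h⁻¹ : Gamma0 N) : SL(2, ℤ)) := by
          rw [Subgroup.coe_inv]; group
        rw [e]; exact hδ
    exact Subgroup.finiteIndex_of_finite_quotient
  · -- NORMAL in `Γ₀(N)`
    rintro g hg γ ⟨hγ, k, ν, hν, e⟩
    have hmemg : g * γ * g⁻¹ ∈ Gamma0 N := (Gamma0 N).mul_mem ((Gamma0 N).mul_mem hg hγ) ((Gamma0 N).inv_mem hg)
    refine ⟨hmemg, k, ν, hν, ?_⟩
    have : (⟨g * γ * g⁻¹, hmemg⟩ : Gamma0 N) = ⟨g, hg⟩ * ⟨γ, hγ⟩ * ⟨g, hg⟩⁻¹ := rfl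
    rw [this, cuspSymbol_mul_holds, cuspSymbol_mul_holds, cuspSymbol_inv, ← e]; ring
  · -- trace `±2` ⟹ zero discriminant ⟹ zero period
    intro γ hγ htr
    refine ⟨hγ, 0, 0, zero_mem _, ?_⟩
    have hdet : ((γ : Matrix (Fin 2) (Fin 2) ℤ)).det = 1 := γ.2
    have hdisc : ((((⟨γ, hγ⟩ : Gamma0 N) : SL(2, ℤ)) : Matrix (Fin 2) (Fin 2) ℤ)).discr = 0 := by
      show ((γ : Matrix (Fin 2) (Fin 2) ℤ)).discr = 0
      rw [Matrix.discr_fin_two, Matrix.trace_fin_two, hdet]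
      rcases htr with h | h <;> rw [h] <;> norm_num
    rw [cuspSymbol_eq_zero_of_discr_eq_zero D.f hdisc]; simp

end Summit.BirchSwinnertonDyer.BirchSwinnertonDyer.Theorems.ManinLocalTwoThree

end
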